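import Literature.Analysis.FluidPDE.HomogeneousEulerFlux
import Literature.Analysis.FluidPDE.HomogeneousEulerProofs
import Literature.Analysis.FluidPDE.HomogeneousEulerBernoulliRigidity
import Mathlib.Analysis.SpecialFunctions.SmoothTransition
import HarnessLib

/-!
# Shvydkoy 2018, Lemma 6.1 — the sphere moments `∫_{S²} f Hⁿ dσ` of a homogeneous stationary
# Euler pair vanish: PROOF of the named fact `shvydkoy2018_lemma61_sphereMoments`

R. Shvydkoy, *Homogeneous solutions to the 3D Euler system*, Trans. Amer. Math. Soc. **370**
(2018) 2517–2535 = arXiv:1510.03378 [`Shvydkoy2018`], §6.3, Lemma 6.1 (arXiv p. 14): "For any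
`α ∈ ℝ` and smooth solution (2) we have `∫_{S²} f Hⁿ dσ = 0` for all `n ∈ ℕ`, and even for
`n = 0` if `α ≠ 2`."  The tree holds this statement as the named fact
`shvydkoy2018_lemma61_sphereMoments` (`HomogeneousEulerFlux.lean`, D-0014; consumer: the
AnomalousDissipation `PointFluxCone` negative record `ClassicalFluxRigidity.lean`, which proves
the shell form of the case `n = 1`, `α = 2/3` on its own).  This file proves it:
`shvydkoy2018_lemma61_sphereMoments_holds`.  Only the `C¹` regularity packaged in
`IsHomogeneousSteadyEuler` is used (the fact's `C^∞` hypotheses are not needed).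

## The printed proof and the proof given here

Printed (arXiv p. 14): "Multiplying (H) [`v∇H = 2αfH`, arXiv p. 5 eq. (8)] with `Hⁿ⁻¹` and
integrating over the sphere we obtain `∫ f Hⁿ dσ = 0` for all `n ∈ ℕ` except a possible `n₀`
for which `α = 2/(1+2n₀)`.  To prove the identity for `n = n₀` … `∫ f H^{n₀} Hᵏ dσ = 0` for all
`k ≥ 1`.  Consequently `∫ f H^{n₀} G(H) dσ = 0` for all real analytic `G` with `G(0) = 0`.
Letting `G(x) = 1 - e^{-x²/ε}` and `ε → 0` we obtain `∫_{H ≠ 0} f H^{n₀} dσ = 0`.  However on the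
set `{H = 0}` the integral vanishes trivially.  When `α ≠ 2` we also have `∫ f dσ = 0` directly
from (6)₁."

Here the sphere calculus is done in the bulk, as in the tree's other Shvydkoy files
(`HomogeneousEulerProofs.lean`, `HomogeneousEulerBernoulliRigidity.lean`): with
`Q = ‖V‖² + 2P = H/|x|^{2α}` and `F = ⟪V, x⟫ = f |x|^{1-α}`,

* (B) **renormalised Bernoulli transport** (`divergence_renormalised_eq_zero`): for every `C¹`
  function `φ`, `div (φ(Q) V) = φ'(Q) DQ(V) + φ(Q) div V = 0` off the origin — the bulk form of
  "multiplying (H) with `Hⁿ⁻¹`";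
* one integration by parts against a radial test function `σ(‖x‖)`
  (`Shvydkoy2018.integral_fderiv_apply_add_mul_divergence_eq_zero`) and polar coordinates
  (`integral_eq_integral_Ioi_sphereIntegral`, `SphereIntegral.lean`) give the radial identity
  `∫_{(0,∞)} σ'(r) Φ(r) dr = 0`, `Φ(r) = r^{n-1} r⁻¹ ∫ ⟪V, x⟫ φ(Q) (rα) dσ(α)` the flux of
  `φ(Q) V` through the sphere of radius `r` (`integral_radialTest_eq_zero`,
  `integral_Ioi_deriv_mul_flux_eq_zero`);
* (A) **du Bois-Reymond's lemma** on `(0, ∞)` (private, proved here with the explicit smooth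
  monotone steps `smoothTransition ((r - c + ε)/ε)` as approximate identities) turns this into
  the **constancy of the flux** `Φ` (`flux_eq_flux`) — "integrating over the sphere";
* (C) homogeneity (2) under the sphere integral (`sphereIntegral_moment_eq_rpow_mul`):
  `∫ ⟪V, x⟫ φ(Q) (rα) dσ = r^{1-α} ∫ f φ(r^{-2α} H) dσ`;
* (D) `φ = sⁿ`: `Φ(r) = r^{2 - α(2n+1)} ∫ f Hⁿ dσ` in dimension `3`, so `∫ f Hⁿ dσ = 0` unless
  `α (2n+1) = 2` (`sphereIntegral_moment_eq_zero_of_ne`; `n = 0`: `α ≠ 2`);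
* (E) the exceptional exponent `α = 2/(2n+1)`, `n ≥ 1` (`sphereIntegral_moment_eq_zero_of_eq`):
  instead of the printed analytic approximation `G(H) = 1 - e^{-H²/ε}` we run the same
  `ε → 0` / dominated-convergence argument on the bounded renormalisation `φ(s) = sⁿ/(1+s²)`
  (a shorter road in Lean): its flux is `Ψ(t) = ∫ f Hⁿ/(1 + t²H²) dσ` with `t = r^{-2α}`,
  constant in `t > 0` by flux constancy, tending to `∫ f Hⁿ dσ` as `t → 0` and to
  `∫_{H=0} f Hⁿ dσ = 0` as `t → ∞`.

No new definitions, no named facts, no `sorry`; axioms standard.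

## References

* R. Shvydkoy, Trans. Amer. Math. Soc. 370 (2018) 2517–2535, doi:10.1090/tran/7022 =
  arXiv:1510.03378: eq. (2) (arXiv p. 3), eq. (8) = (H) (arXiv p. 5), §6.3 Lemma 6.1 and its
  proof (arXiv p. 14). [`Shvydkoy2018`]

## Mathlib / tree search

Reused from the tree: `IsHomogeneousSteadyEuler` (+ `.normalPart_smul_eq`, `.bernoulliFn_smul_eq`
of `HomogeneousEulerBernoulliRigidity.lean`), `Shvydkoy2018.hasFDerivAt_bernoulliFn`,
`….divergence_smul_apply`, `….integral_fderiv_apply_add_mul_divergence_eq_zero`,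
`….continuous_of_off_origin`, `….inner_gradient_left` (`HomogeneousEulerProofs.lean`),
`sphereIntegral`, `integral_eq_integral_Ioi_sphereIntegral`, `continuousOn_sphereIntegral_Ioi`,
`norm_smul_sphere` (`SphereIntegral.lean`).  From Mathlib: `Real.smoothTransition` (`.monotone`,
`.zero_of_nonpos`, `.one_of_one_le`, `.contDiff`), `Monotone.deriv_nonneg`,
`intervalIntegral.integral_deriv_eq_sub`, `hasStrictFDerivAt_norm_sq`, `Real.hasDerivAt_sqrt`,
`tendsto_integral_of_dominated_convergence`, `tendsto_one_div_add_atTop_nhds_zero_nat`,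
`tendsto_inv_atTop_zero`, `finrank_euclideanSpace_fin`.  `lean search 'lemma61|sphereMoments'`:
no `_holds` in the tree before this file.
-/

noncomputable section

open Set Filter MeasureTheory Module Metric
open scoped InnerProductSpace RealInnerProductSpace Topology

namespace Literature.Analysis.FluidPDE

namespace IsHomogeneousSteadyEuler

/-! ### A. One-variable tools: smooth monotone steps, and the du Bois-Reymond lemma on `(0, ∞)` -/

section OneVariable

/-- The smooth monotone step `Λ(r) = smoothTransition ((r - c + ε)/ε)` is `C¹`. [folklore] -/
private theorem step_contDiff (c ε : ℝ) :
    ContDiff ℝ 1 (fun r : ℝ => Real.smoothTransition ((r - c + ε) / ε)) :=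
  Real.smoothTransition.contDiff.comp
    (((contDiff_id.sub contDiff_const).add contDiff_const).div_const ε)

/-- `Λ = 0` on `(-∞, c - ε]`. [folklore] -/
private theorem step_eq_zero {c ε r : ℝ} (hε : 0 < ε) (hr : r ≤ c - ε) :
    Real.smoothTransition ((r - c + ε) / ε) = 0 :=
  Real.smoothTransition.zero_of_nonpos (div_nonpos_of_nonpos_of_nonneg (by linarith) hε.le)

/-- `Λ = 1` on `[c, ∞)`. [folklore] -/
private theorem step_eq_one {c ε r : ℝ} (hε : 0 < ε) (hr : c ≤ r) :
    Real.smoothTransition ((r - c + ε) / ε) = 1 :=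
  Real.smoothTransition.one_of_one_le ((one_le_div hε).2 (by linarith))

/-- `Λ` is monotone. [folklore] -/
private theorem step_monotone (c : ℝ) {ε : ℝ} (hε : 0 < ε) :
    Monotone (fun r : ℝ => Real.smoothTransition ((r - c + ε) / ε)) :=
  Real.smoothTransition.monotone.comp fun _ _ hrs =>
    div_le_div_of_nonneg_right (by linarith) hε.le

/-- `Λ' ≥ 0`. [folklore] -/
private theorem deriv_step_nonneg (c : ℝ) {ε : ℝ} (hε : 0 < ε) (r : ℝ) :
    0 ≤ deriv (fun r : ℝ => Real.smoothTransition ((r - c + ε) / ε)) r :=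
  (step_monotone c hε).deriv_nonneg

/-- `Λ' = 0` off `[c - ε, c]`. [folklore] -/
private theorem deriv_step_eq_zero {c ε r : ℝ} (hε : 0 < ε) (hr : r < c - ε ∨ c < r) :
    deriv (fun r : ℝ => Real.smoothTransition ((r - c + ε) / ε)) r = 0 := by
  rcases hr with hr | hr
  · have hev : (fun r : ℝ => Real.smoothTransition ((r - c + ε) / ε)) =ᶠ[𝓝 r]
        fun _ => (0 : ℝ) := by
      filter_upwards [Iio_mem_nhds hr] with s hs using step_eq_zero hε (le_of_lt hs)
    rw [hev.deriv_eq, deriv_const]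
  · have hev : (fun r : ℝ => Real.smoothTransition ((r - c + ε) / ε)) =ᶠ[𝓝 r]
        fun _ => (1 : ℝ) := by
      filter_upwards [Ioi_mem_nhds hr] with s hs using step_eq_one hε (le_of_lt hs)
    rw [hev.deriv_eq, deriv_const]

/-- `∫_{c-2ε}^{c} Λ' = 1`. [folklore] -/
private theorem integral_deriv_step {c ε : ℝ} (hε : 0 < ε) :
    ∫ r in (c - 2 * ε)..c, deriv (fun r : ℝ => Real.smoothTransition ((r - c + ε) / ε)) r = 1 := by
  rw [intervalIntegral.integral_deriv_eq_sub
      (fun r _ => (step_contDiff c ε).differentiable one_ne_zero r)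
      (((step_contDiff c ε).continuous_deriv le_rfl).intervalIntegrable _ _),
    step_eq_one hε le_rfl, step_eq_zero hε (by linarith)]
  norm_num

/-- The kernel `Λ' G` is the indicator of `[c - 2ε, c]` times itself. [folklore] -/
private theorem kernel_mul_eq_indicator (G : ℝ → ℝ) {c ε : ℝ} (hε : 0 < ε) :
    (fun r => deriv (fun r : ℝ => Real.smoothTransition ((r - c + ε) / ε)) r * G r) =
      (Icc (c - 2 * ε) c).indicator
        fun r => deriv (fun r : ℝ => Real.smoothTransition ((r - c + ε) / ε)) r * G r := by
  funext r
  by_cases hr : r ∈ Icc (c - 2 * ε) c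
  · rw [indicator_of_mem hr]
  · rw [indicator_of_notMem hr]
    rw [mem_Icc, not_and_or, not_le, not_le] at hr
    rcases hr with hr | hr
    · rw [deriv_step_eq_zero hε (Or.inl (by linarith)), zero_mul]
    · rw [deriv_step_eq_zero hε (Or.inr hr), zero_mul]

/-- Integrability of the kernel `Λ' G` on `(0, ∞)` for `G` continuous on `[c - 2ε, c] ⊂ (0, ∞)`.
[folklore] -/
private theorem kernel_integrableOn {G : ℝ → ℝ} {c ε : ℝ} (hε : 0 < ε)
    (hG : ContinuousOn G (Icc (c - 2 * ε) c)) :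
    IntegrableOn (fun r => deriv (fun r : ℝ => Real.smoothTransition ((r - c + ε) / ε)) r * G r)
      (Ioi 0) := by
  rw [kernel_mul_eq_indicator G hε]
  exact (((((step_contDiff c ε).continuous_deriv le_rfl).continuousOn.mul hG).integrableOn_compact
    isCompact_Icc).integrable_indicator measurableSet_Icc).integrableOn

/-- **Approximate identity.** If `|G - G(c)| ≤ δ` on `[c - 2ε, c] ⊂ (0,∞)` then
`|∫_{(0,∞)} Λ' G - G(c)| ≤ δ` (`Λ' ≥ 0`, `∫ Λ' = 1`). [folklore] -/
private theorem kernel_estimate {G : ℝ → ℝ} {c ε δ : ℝ} (hε : 0 < ε) (hc : 2 * ε < c)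
    (hG : ContinuousOn G (Icc (c - 2 * ε) c))
    (hδ : ∀ r ∈ Icc (c - 2 * ε) c, |G r - G c| ≤ δ) :
    |(∫ r in Ioi (0 : ℝ),
        deriv (fun r : ℝ => Real.smoothTransition ((r - c + ε) / ε)) r * G r) - G c| ≤ δ := by
  set κ : ℝ → ℝ := deriv (fun r : ℝ => Real.smoothTransition ((r - c + ε) / ε)) with hκ
  have hκc : Continuous κ := (step_contDiff c ε).continuous_deriv le_rfl
  have hle : c - 2 * ε ≤ c := by linarith
  -- reduce the integral over `(0, ∞)` to the interval `[c - 2ε, c]`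
  have hI : ∫ r in Ioi (0 : ℝ), κ r * G r = ∫ r in (c - 2 * ε)..c, κ r * G r := by
    rw [intervalIntegral.integral_of_le hle, ← integral_Icc_eq_integral_Ioc, hκ]
    conv_lhs => rw [kernel_mul_eq_indicator G hε]
    rw [setIntegral_indicator measurableSet_Icc,
      show Ioi (0 : ℝ) ∩ Icc (c - 2 * ε) c = Icc (c - 2 * ε) c from
        inter_eq_right.2 fun r hr => lt_of_lt_of_le (by linarith) hr.1]
  rw [hI]
  have hκi : IntervalIntegrable κ volume (c - 2 * ε) c := hκc.intervalIntegrable _ _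
  have hκGi : IntervalIntegrable (fun r => κ r * G r) volume (c - 2 * ε) c := by
    refine ContinuousOn.intervalIntegrable ?_
    rw [uIcc_of_le hle]
    exact hκc.continuousOn.mul hG
  have hκGci : IntervalIntegrable (fun r => κ r * (G r - G c)) volume (c - 2 * ε) c := by
    refine ContinuousOn.intervalIntegrable ?_
    rw [uIcc_of_le hle]
    exact hκc.continuousOn.mul (hG.sub continuousOn_const)
  have h1 : ∫ r in (c - 2 * ε)..c, κ r = 1 := integral_deriv_step hε
  have hsub : (∫ r in (c - 2 * ε)..c, κ r * G r) - G c =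
      ∫ r in (c - 2 * ε)..c, κ r * (G r - G c) := by
    have e : (∫ r in (c - 2 * ε)..c, κ r * (G r - G c)) =
        (∫ r in (c - 2 * ε)..c, κ r * G r) - (∫ r in (c - 2 * ε)..c, κ r * G c) := by
      rw [← intervalIntegral.integral_sub hκGi (hκi.mul_const _)]
      refine intervalIntegral.integral_congr fun r _ => ?_
      ring
    rw [e, intervalIntegral.integral_mul_const, h1, one_mul]
  rw [hsub]
  calc |∫ r in (c - 2 * ε)..c, κ r * (G r - G c)|
      ≤ ∫ r in (c - 2 * ε)..c, |κ r * (G r - G c)| :=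
        intervalIntegral.abs_integral_le_integral_abs hle
    _ ≤ ∫ r in (c - 2 * ε)..c, κ r * δ := by
        refine intervalIntegral.integral_mono_on hle hκGci.abs (hκi.mul_const _) fun r hr => ?_
        rw [abs_mul, abs_of_nonneg (deriv_step_nonneg c hε r)]
        exact mul_le_mul_of_nonneg_left (hδ r hr) (deriv_step_nonneg c hε r)
    _ = δ := by rw [intervalIntegral.integral_mul_const, h1, one_mul]

/-- **du Bois-Reymond's lemma on `(0, ∞)`.** A function `G` continuous on `(0, ∞)` with
`∫_{(0,∞)} σ' G = 0` for every `C¹` test function `σ` compactly supported in `(0, ∞)` is constant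
on `(0, ∞)`. [folklore] -/
private theorem duBoisReymond {G : ℝ → ℝ} (hG : ContinuousOn G (Ioi 0))
    (hint : ∀ σ : ℝ → ℝ, ContDiff ℝ 1 σ → HasCompactSupport σ → σ =ᶠ[𝓝 0] 0 →
      ∫ r in Ioi (0 : ℝ), deriv σ r * G r = 0)
    ⦃a b : ℝ⦄ (ha : 0 < a) (hb : 0 < b) : G a = G b := by
  -- continuity moduli at `a` and `b`
  have hmod : ∀ {c : ℝ}, 0 < c → ∀ δ : ℝ, 0 < δ →
      ∃ e : ℝ, 0 < e ∧ ∀ r, |r - c| ≤ e → |G r - G c| ≤ δ := by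
    intro c hc δ hδ
    have hca : ContinuousAt G c := hG.continuousAt (Ioi_mem_nhds hc)
    rcases Metric.continuousAt_iff.1 hca δ hδ with ⟨e, he, h⟩
    refine ⟨e / 2, by positivity, fun r hr => le_of_lt ?_⟩
    have hd : dist r c < e := by rw [Real.dist_eq]; linarith
    have := h hd
    rwa [Real.dist_eq] at this
  -- `|G a - G b| ≤ 2δ` for every `δ > 0`
  have key : ∀ δ : ℝ, 0 < δ → |G a - G b| ≤ 2 * δ := by
    intro δ hδ
    obtain ⟨e₁, he₁, h₁⟩ := hmod ha δ hδ
    obtain ⟨e₂, he₂, h₂⟩ := hmod hb δ hδ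
    set ε : ℝ := min (min e₁ e₂) (min a b) / 4 with hε_def
    have hm1 : min (min e₁ e₂) (min a b) ≤ e₁ := (min_le_left _ _).trans (min_le_left _ _)
    have hm2 : min (min e₁ e₂) (min a b) ≤ e₂ := (min_le_left _ _).trans (min_le_right _ _)
    have hma : min (min e₁ e₂) (min a b) ≤ a := (min_le_right _ _).trans (min_le_left _ _)
    have hmb : min (min e₁ e₂) (min a b) ≤ b := (min_le_right _ _).trans (min_le_right _ _)
    have hmpos : 0 < min (min e₁ e₂) (min a b) := lt_min (lt_min he₁ he₂) (lt_min ha hb)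
    have hε : 0 < ε := by rw [hε_def]; positivity
    have hεa : 2 * ε < a := by rw [hε_def]; linarith
    have hεb : 2 * ε < b := by rw [hε_def]; linarith
    have hε1 : 2 * ε ≤ e₁ := by rw [hε_def]; linarith
    have hε2 : 2 * ε ≤ e₂ := by rw [hε_def]; linarith
    -- the test function `σ = Λ_a - Λ_b`
    set σ : ℝ → ℝ := fun r =>
      Real.smoothTransition ((r - a + ε) / ε) - Real.smoothTransition ((r - b + ε) / ε) with hσ_def
    have hσ1 : ContDiff ℝ 1 σ := (step_contDiff a ε).sub (step_contDiff b ε)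
    have hσlo : ∀ r, r ≤ min a b - ε → σ r = 0 := fun r hr => by
      simp only [hσ_def]
      rw [step_eq_zero hε (hr.trans (sub_le_sub_right (min_le_left a b) ε)),
        step_eq_zero hε (hr.trans (sub_le_sub_right (min_le_right a b) ε)), sub_zero]
    have hσhi : ∀ r, max a b ≤ r → σ r = 0 := fun r hr => by
      simp only [hσ_def]
      rw [step_eq_one hε ((le_max_left a b).trans hr), step_eq_one hε ((le_max_right a b).trans hr),
        sub_self]
    have hσ2 : HasCompactSupport σ := by
      refine HasCompactSupport.intro (isCompact_Icc : IsCompact (Icc (min a b - ε) (max a b)))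
        fun r hr => ?_
      rw [mem_Icc, not_and_or, not_le, not_le] at hr
      rcases hr with hr | hr
      · exact hσlo r hr.le
      · exact hσhi r hr.le
    have hσ3 : σ =ᶠ[𝓝 0] 0 := by
      have hpos : 0 < min a b - ε := by
        have : 4 * ε ≤ min a b := by rw [hε_def]; linarith [min_le_right (min e₁ e₂) (min a b)]
        linarith
      filter_upwards [Iio_mem_nhds hpos] with r hr using hσlo r (le_of_lt hr)
    have h0 := hint σ hσ1 hσ2 hσ3
    -- `σ' = Λ_a' - Λ_b'`
    have hdσ : ∀ r, deriv σ r =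
        deriv (fun r : ℝ => Real.smoothTransition ((r - a + ε) / ε)) r -
          deriv (fun r : ℝ => Real.smoothTransition ((r - b + ε) / ε)) r := fun r =>
      deriv_sub ((step_contDiff a ε).differentiable one_ne_zero r)
        ((step_contDiff b ε).differentiable one_ne_zero r)
    have hGa : ContinuousOn G (Icc (a - 2 * ε) a) :=
      hG.mono fun r hr => lt_of_lt_of_le (by linarith) hr.1
    have hGb : ContinuousOn G (Icc (b - 2 * ε) b) :=
      hG.mono fun r hr => lt_of_lt_of_le (by linarith) hr.1
    have hIa := kernel_integrableOn hε hGa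
    have hIb := kernel_integrableOn hε hGb
    have hsplit : ∫ r in Ioi (0 : ℝ), deriv σ r * G r =
        (∫ r in Ioi (0 : ℝ), deriv (fun r : ℝ => Real.smoothTransition ((r - a + ε) / ε)) r * G r) -
          ∫ r in Ioi (0 : ℝ),
            deriv (fun r : ℝ => Real.smoothTransition ((r - b + ε) / ε)) r * G r := by
      rw [← integral_sub hIa hIb]
      refine setIntegral_congr_fun (measurableSet_Ioi : MeasurableSet (Ioi (0 : ℝ))) fun r _ => ?_
      rw [hdσ r]
      ring
    have hea := kernel_estimate hε hεa hGa fun r hr => h₁ r (by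
      rw [abs_le]; constructor <;> linarith [hr.1, hr.2])
    have heb := kernel_estimate hε hεb hGb fun r hr => h₂ r (by
      rw [abs_le]; constructor <;> linarith [hr.1, hr.2])
    rw [hsplit] at h0
    calc |G a - G b|
        = |((∫ r in Ioi (0 : ℝ),
              deriv (fun r : ℝ => Real.smoothTransition ((r - b + ε) / ε)) r * G r) - G b) -
            ((∫ r in Ioi (0 : ℝ),
              deriv (fun r : ℝ => Real.smoothTransition ((r - a + ε) / ε)) r * G r) - G a)| := by
          congr 1
          linarith
      _ ≤ |(∫ r in Ioi (0 : ℝ),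
              deriv (fun r : ℝ => Real.smoothTransition ((r - b + ε) / ε)) r * G r) - G b| +
            |(∫ r in Ioi (0 : ℝ),
              deriv (fun r : ℝ => Real.smoothTransition ((r - a + ε) / ε)) r * G r) - G a| :=
          abs_sub _ _
      _ ≤ δ + δ := add_le_add heb hea
      _ = 2 * δ := by ring
  -- conclude
  by_contra hne
  have hpos : 0 < |G a - G b| := abs_pos.2 (sub_ne_zero.2 hne)
  have := key (|G a - G b| / 4) (by positivity)
  linarith

end OneVariable

/-! ### B. Renormalised Bernoulli transport and the constancy of the flux through spheres -/

section Flux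

variable {E : Type*} [NormedAddCommGroup E] [InnerProductSpace ℝ E] [FiniteDimensional ℝ E]
  [MeasurableSpace E] [BorelSpace E]
variable {α : ℝ} {V : E → E} {P : E → ℝ}

omit [FiniteDimensional ℝ E] [MeasurableSpace E] [BorelSpace E] in
/-- The derivative of the norm off the origin: `D‖·‖(x) w = ⟪x, w⟫/‖x‖`. [folklore] -/
private theorem hasFDerivAt_norm_of_ne_zero {x : E} (hx : x ≠ 0) :
    HasFDerivAt (fun y : E => ‖y‖) (‖x‖⁻¹ • innerSL ℝ x) x := by
  have h1 : HasFDerivAt (fun y : E => ‖y‖ ^ 2) (2 • innerSL ℝ x) x :=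
    (hasStrictFDerivAt_norm_sq x).hasFDerivAt
  have hx2 : ‖x‖ ^ 2 ≠ 0 := pow_ne_zero 2 (norm_ne_zero_iff.2 hx)
  have h2 : HasDerivAt Real.sqrt (1 / (2 * √(‖x‖ ^ 2))) (‖x‖ ^ 2) := Real.hasDerivAt_sqrt hx2
  have h3 := h2.comp_hasFDerivAt x h1
  have heq : (Real.sqrt ∘ fun y : E => ‖y‖ ^ 2) = fun y => ‖y‖ := by
    funext y
    simp [Real.sqrt_sq (norm_nonneg y)]
  rw [heq, Real.sqrt_sq (norm_nonneg x)] at h3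
  refine h3.congr_fderiv ?_
  ext w
  simp only [smul_apply, smul_eq_mul, innerSL_apply_apply, nsmul_eq_mul, Nat.cast_ofNat]
  field_simp

variable (μ : Measure E) [μ.IsAddHaarMeasure]

section Engine

variable (h : IsHomogeneousSteadyEuler α V P)
include h

omit [MeasurableSpace E] [BorelSpace E] in
/-- The Bernoulli function `‖V‖² + 2P` is `C¹` off the origin. [folklore] -/
private theorem contDiffOn_bernoulliFn' :
    ContDiffOn ℝ 1 (fun y => ‖V y‖ ^ 2 + 2 * P y) {x | x ≠ 0} :=
  (h.contDiffOn_velocity.norm_sq ℝ).add (contDiffOn_const.mul h.contDiffOn_pressure)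

omit [MeasurableSpace E] [BorelSpace E] in
/-- **Renormalised Bernoulli transport.** For every `C¹` function `φ` the field `φ(‖V‖² + 2P) V`
is divergence free off the origin: `div (φ(Q) V) = φ'(Q) DQ(V) + φ(Q) div V = 0`, because the
Bernoulli function `Q = ‖V‖² + 2P` is transported (`DQ(V) = 2⟪DV V + ∇P, V⟫ = 0`, the momentum
equation) and `div V = 0` — the bulk form of "multiplying (H) `v∇H = 2αfH` with `Hⁿ⁻¹`".
[cite: Shvydkoy2018, (8) (arXiv p. 5) and proof of Lemma 6.1 (arXiv p. 14)] -/
theorem divergence_renormalised_eq_zero {φ : ℝ → ℝ} (hφ : ContDiff ℝ 1 φ) {x : E} (hx : x ≠ 0) :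
    VectorCalculus.divergence (fun y => φ (‖V y‖ ^ 2 + 2 * P y) • V y) x = 0 := by
  have hVd := h.differentiableAt_velocity hx
  have hPd := h.differentiableAt_pressure hx
  have hQ := Shvydkoy2018.hasFDerivAt_bernoulliFn hVd hPd
  have hφd : DifferentiableAt ℝ φ (‖V x‖ ^ 2 + 2 * P x) := hφ.differentiable one_ne_zero _
  have hcomp : HasFDerivAt (fun y => φ (‖V y‖ ^ 2 + 2 * P y))
      (deriv φ (‖V x‖ ^ 2 + 2 * P x) •
        (2 • (innerSL ℝ (V x)).comp (fderiv ℝ V x) + (2 : ℝ) • fderiv ℝ P x)) x :=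
    hφd.hasDerivAt.comp_hasFDerivAt x hQ
  rw [Shvydkoy2018.divergence_smul_apply (stdOrthonormalBasis ℝ E) hcomp.differentiableAt hVd,
    h.divergence_eq_zero hx, mul_zero, zero_add, hcomp.fderiv]
  have hm : ⟪fderiv ℝ V x (V x), V x⟫ = -fderiv ℝ P x (V x) := by
    have hmom := h.momentum hx
    rw [convect_apply, add_eq_zero_iff_eq_neg] at hmom
    rw [hmom, inner_neg_left, Shvydkoy2018.inner_gradient_left]
  simp only [smul_apply, add_apply, ContinuousLinearMap.comp_apply, innerSL_apply_apply,
    smul_eq_mul, nsmul_eq_mul, Nat.cast_ofNat]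
  rw [real_inner_comm, hm]
  ring

/-- **The bulk identity behind the flux computation.** For a `C¹` renormalisation `φ` and a `C¹`
radial test profile `σ` compactly supported in `(0, ∞)`,
`∫ σ'(‖x‖) ‖x‖⁻¹ ⟪V x, x⟫ φ(Q x) dμ = 0` — the integral of `div (σ(‖x‖) φ(Q) V)`
(`Shvydkoy2018.integral_fderiv_apply_add_mul_divergence_eq_zero` with `G = 1`), since
`div (φ(Q) V) = 0` and `D(σ ∘ ‖·‖)(x) V = σ'(‖x‖) ⟪x, V⟫/‖x‖`.
[cite: Shvydkoy2018, proof of Lemma 6.1 (arXiv p. 14)] -/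
theorem integral_radialTest_eq_zero {φ : ℝ → ℝ} (hφ : ContDiff ℝ 1 φ) {σ : ℝ → ℝ}
    (hσ : ContDiff ℝ 1 σ) (hσc : HasCompactSupport σ) (hσ0 : σ =ᶠ[𝓝 0] 0) :
    ∫ x, deriv σ ‖x‖ * (‖x‖⁻¹ * (⟪V x, x⟫ * φ (‖V x‖ ^ 2 + 2 * P x))) ∂μ = 0 := by
  set U : E → E := fun y => φ (‖V y‖ ^ 2 + 2 * P y) • V y with hU
  set W : E → E := fun y => σ ‖y‖ • U y with hW
  have hUreg : ContDiffOn ℝ 1 U {x | x ≠ 0} :=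
    (hφ.comp_contDiffOn h.contDiffOn_bernoulliFn').smul h.contDiffOn_velocity
  have hθreg : ContDiffOn ℝ 1 (fun y : E => σ ‖y‖) {x | x ≠ 0} :=
    hσ.comp_contDiffOn (contDiffOn_id.norm ℝ fun x hx => hx)
  have hWreg : ContDiffOn ℝ 1 W {x | x ≠ 0} := hθreg.smul hUreg
  -- `σ` vanishes on `(-δ, δ)`, so `W` vanishes on the ball of radius `δ`
  obtain ⟨δ, hδ, hσδ⟩ : ∃ δ > 0, ∀ r : ℝ, |r| < δ → σ r = 0 := by
    rcases Metric.eventually_nhds_iff.1 hσ0 with ⟨δ, hδ, hδ'⟩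
    exact ⟨δ, hδ, fun r hr => hδ' (by simpa [Real.dist_eq] using hr)⟩
  have hW0 : W =ᶠ[𝓝 0] 0 := by
    filter_upwards [Metric.ball_mem_nhds (0 : E) hδ] with y hy
    rw [mem_ball_zero_iff] at hy
    simp [hW, hσδ ‖y‖ (by rwa [abs_norm])]
  -- `σ` is supported in `[-R, R]`, so `W` is supported in the closed ball of radius `R`
  obtain ⟨R, hR⟩ : ∃ R, ∀ r : ℝ, R < |r| → σ r = 0 := by
    obtain ⟨R, hR⟩ := hσc.isCompact.isBounded.subset_closedBall 0
    refine ⟨R, fun r hr => ?_⟩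
    by_contra hne
    have hmem : r ∈ tsupport σ := subset_tsupport _ (Function.mem_support.2 hne)
    have := hR hmem
    rw [mem_closedBall, dist_zero_right, Real.norm_eq_abs] at this
    linarith
  have hWc : HasCompactSupport W := by
    refine HasCompactSupport.intro (isCompact_closedBall (0 : E) R) fun y hy => ?_
    rw [mem_closedBall, dist_zero_right, not_le] at hy
    simp [hW, hR ‖y‖ (by rwa [abs_norm])]
  have key := Shvydkoy2018.integral_fderiv_apply_add_mul_divergence_eq_zero μ hWreg hW0 hWc
    (contDiffOn_const : ContDiffOn ℝ 1 (fun _ : E => (1 : ℝ)) {x | x ≠ 0})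
  -- pointwise: `D1·W + 1·div W = σ'(‖x‖) ‖x‖⁻¹ ⟪V x, x⟫ φ(Q x)`
  have hpt : ∀ x, fderiv ℝ (fun _ : E => (1 : ℝ)) x (W x)
      + (fun _ : E => (1 : ℝ)) x * VectorCalculus.divergence W x =
      deriv σ ‖x‖ * (‖x‖⁻¹ * (⟪V x, x⟫ * φ (‖V x‖ ^ 2 + 2 * P x))) := by
    intro x
    rw [fderiv_const_apply, zero_apply, zero_add, one_mul]
    rcases eq_or_ne x 0 with rfl | hx
    · have hDW0 : fderiv ℝ W 0 = 0 := by
        rw [hW0.fderiv_eq]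
        exact fderiv_const_apply _
      simp [VectorCalculus.divergence, hDW0]
    · have hθd : HasFDerivAt (fun y : E => σ ‖y‖) (deriv σ ‖x‖ • (‖x‖⁻¹ • innerSL ℝ x)) x :=
        ((hσ.differentiable one_ne_zero) _).hasDerivAt.comp_hasFDerivAt x
          (hasFDerivAt_norm_of_ne_zero hx)
      have hUd : DifferentiableAt ℝ U x :=
        (hUreg.differentiableOn one_ne_zero).differentiableAt (isOpen_ne.mem_nhds hx)
      rw [hW, Shvydkoy2018.divergence_smul_apply (stdOrthonormalBasis ℝ E) hθd.differentiableAt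
        hUd, show VectorCalculus.divergence U x = 0 from h.divergence_renormalised_eq_zero hφ hx,
        hθd.fderiv]
      simp only [hU, smul_apply, innerSL_apply_apply, smul_eq_mul,
        real_inner_smul_right, mul_zero, zero_add]
      rw [real_inner_comm]
      ring
  have hcongr : ∫ x, deriv σ ‖x‖ * (‖x‖⁻¹ * (⟪V x, x⟫ * φ (‖V x‖ ^ 2 + 2 * P x))) ∂μ =
      ∫ x, (fderiv ℝ (fun _ : E => (1 : ℝ)) x (W x)
        + (fun _ : E => (1 : ℝ)) x * VectorCalculus.divergence W x) ∂μ :=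
    integral_congr_ae (ae_of_all _ fun x => (hpt x).symm)
  rw [hcongr]
  exact key

omit [MeasurableSpace E] [BorelSpace E] in
/-- The moment integrand `⟪V, x⟫ φ(Q)` is continuous off the origin. [folklore] -/
private theorem continuousOn_moment {φ : ℝ → ℝ} (hφ : ContDiff ℝ 1 φ) :
    ContinuousOn (fun x => ⟪V x, x⟫ * φ (‖V x‖ ^ 2 + 2 * P x)) {0}ᶜ := by
  have hs : ({0}ᶜ : Set E) = {x | x ≠ 0} := by
    ext x
    simp
  rw [hs]
  exact (h.contDiffOn_velocity.continuousOn.inner continuousOn_id).mul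
    (hφ.continuous.comp_continuousOn h.contDiffOn_bernoulliFn'.continuousOn)

/-- **The radial identity.** In polar coordinates the bulk identity `integral_radialTest_eq_zero`
reads `∫_{(0,∞)} σ'(r) · r^{n-1} r⁻¹ S(r) dr = 0`, `S(r) = ∫ ⟪V, x⟫ φ(Q) (rα) dσ(α)` the sphere
integral of the moment integrand (`n = dim E`). [cite: Shvydkoy2018, proof of Lemma 6.1 (arXiv p. 14)] -/
theorem integral_Ioi_deriv_mul_flux_eq_zero [Nontrivial E] {φ : ℝ → ℝ} (hφ : ContDiff ℝ 1 φ)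
    {σ : ℝ → ℝ} (hσ : ContDiff ℝ 1 σ) (hσc : HasCompactSupport σ) (hσ0 : σ =ᶠ[𝓝 0] 0) :
    ∫ r in Ioi (0 : ℝ), deriv σ r * (r ^ (finrank ℝ E - 1) * (r⁻¹ *
      sphereIntegral μ (fun x => ⟪V x, x⟫ * φ (‖V x‖ ^ 2 + 2 * P x)) r)) = 0 := by
  set g : E → ℝ := fun x => ⟪V x, x⟫ * φ (‖V x‖ ^ 2 + 2 * P x) with hg
  set f : E → ℝ := fun x => deriv σ ‖x‖ * (‖x‖⁻¹ * g x) with hf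
  have hgc : ContinuousOn g {0}ᶜ := h.continuousOn_moment hφ
  -- `σ'` vanishes near `0` and outside `[-R, R]`
  obtain ⟨δ, hδ, hσδ⟩ : ∃ δ > 0, ∀ r : ℝ, |r| < δ → deriv σ r = 0 := by
    have hd0 : deriv σ =ᶠ[𝓝 0] fun _ => (0 : ℝ) := by
      filter_upwards [eventually_eventually_nhds.mpr hσ0] with r hr
      rw [Filter.EventuallyEq.deriv_eq (hr : σ =ᶠ[𝓝 r] 0)]
      exact deriv_const r (0 : ℝ)
    rcases Metric.eventually_nhds_iff.1 hd0 with ⟨δ, hδ, hδ'⟩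
    exact ⟨δ, hδ, fun r hr => hδ' (by simpa [Real.dist_eq] using hr)⟩
  obtain ⟨R, hR⟩ : ∃ R, ∀ r : ℝ, R < |r| → deriv σ r = 0 := by
    obtain ⟨R, hR⟩ := hσc.deriv.isCompact.isBounded.subset_closedBall 0
    refine ⟨R, fun r hr => ?_⟩
    by_contra hne
    have hmem : r ∈ tsupport (deriv σ) := subset_tsupport _ (Function.mem_support.2 hne)
    have := hR hmem
    rw [mem_closedBall, dist_zero_right, Real.norm_eq_abs] at this
    linarith
  -- `f` is continuous with compact support, hence integrable
  have hfc : Continuous f := by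
    refine Shvydkoy2018.continuous_of_off_origin ?_ ?_
    · have hs : ({x | x ≠ 0} : Set E) = {0}ᶜ := by
        ext x
        simp
      rw [hs]
      exact ((hσ.continuous_deriv le_rfl).comp_continuousOn continuous_norm.continuousOn).mul
        ((continuousOn_inv₀.comp continuous_norm.continuousOn fun x hx => by
          simpa using hx).mul hgc)
    · filter_upwards [Metric.ball_mem_nhds (0 : E) hδ] with y hy
      rw [mem_ball_zero_iff] at hy
      simp [hf, hσδ ‖y‖ (by rwa [abs_norm])]
  have hfcs : HasCompactSupport f := by
    refine HasCompactSupport.intro (isCompact_closedBall (0 : E) R) fun y hy => ?_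
    rw [mem_closedBall, dist_zero_right, not_le] at hy
    simp [hf, hR ‖y‖ (by rwa [abs_norm])]
  have hfi : Integrable f μ := hfc.integrable_of_hasCompactSupport hfcs
  -- polar coordinates
  have hpolar := integral_eq_integral_Ioi_sphereIntegral μ hfi
  have h0 : ∫ r in Ioi (0 : ℝ), (r ^ (finrank ℝ E - 1)) • sphereIntegral μ f r = 0 := by
    rw [← hpolar]
    exact h.integral_radialTest_eq_zero μ hφ hσ hσc hσ0
  -- the sphere integral of `f` at radius `r > 0`
  have hsph : ∀ r : ℝ, 0 < r → sphereIntegral μ f r = deriv σ r * (r⁻¹ * sphereIntegral μ g r) := by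
    intro r hr
    rw [sphereIntegral_def, sphereIntegral_def, ← integral_const_mul, ← integral_const_mul]
    refine integral_congr_ae (ae_of_all _ fun ω => ?_)
    simp only [hf, norm_smul_sphere hr.le ω]
  refine Eq.trans ?_ h0
  refine setIntegral_congr_fun (measurableSet_Ioi : MeasurableSet (Ioi (0 : ℝ))) fun r hr => ?_
  rw [hsph r hr, smul_eq_mul]
  ring

/-- **Constancy of the flux through spheres** (the divergence theorem for the divergence-free
field `φ(Q) V` on shells, obtained from the radial identity by du Bois-Reymond's lemma): for
every `C¹` renormalisation `φ`, `r^{n-1} · r⁻¹ ∫ ⟪V, x⟫ φ(Q) (rα) dσ(α)` — the flux of `φ(Q) V`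
through the sphere of radius `r` — does not depend on `r > 0`.
[cite: Shvydkoy2018, proof of Lemma 6.1 (arXiv p. 14)] -/
theorem flux_eq_flux [Nontrivial E] {φ : ℝ → ℝ} (hφ : ContDiff ℝ 1 φ) ⦃a b : ℝ⦄ (ha : 0 < a)
    (hb : 0 < b) :
    a ^ (finrank ℝ E - 1) * (a⁻¹ *
        sphereIntegral μ (fun x => ⟪V x, x⟫ * φ (‖V x‖ ^ 2 + 2 * P x)) a) =
      b ^ (finrank ℝ E - 1) * (b⁻¹ *
        sphereIntegral μ (fun x => ⟪V x, x⟫ * φ (‖V x‖ ^ 2 + 2 * P x)) b) := by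
  refine duBoisReymond (G := fun r => r ^ (finrank ℝ E - 1) * (r⁻¹ *
    sphereIntegral μ (fun x => ⟪V x, x⟫ * φ (‖V x‖ ^ 2 + 2 * P x)) r)) ?_ ?_ ha hb
  · exact ((continuous_id' : Continuous fun r : ℝ => r).pow _).continuousOn.mul
      ((continuousOn_inv₀.mono fun r hr => ne_of_gt (mem_Ioi.1 hr)).mul
        (continuousOn_sphereIntegral_Ioi μ (h.continuousOn_moment hφ)))
  · intro σ hσ hσc hσ0
    exact h.integral_Ioi_deriv_mul_flux_eq_zero μ hφ hσ hσc hσ0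

omit [BorelSpace E] [μ.IsAddHaarMeasure] in
/-- **Homogeneity under the sphere integral** (Shvydkoy (2): `V(rα) = r^{-α} V(α)`,
`Q(rα) = r^{-2α} Q(α)`): `∫ ⟪V, x⟫ φ(Q) (rα) dσ(α) = r^{1-α} ∫ ⟪V, α⟫ φ(r^{-2α} Q(α)) dσ(α)`.
[cite: Shvydkoy2018, (2) (arXiv p. 3)] -/
theorem sphereIntegral_moment_eq_rpow_mul (φ : ℝ → ℝ) {r : ℝ} (hr : 0 < r) :
    sphereIntegral μ (fun x => ⟪V x, x⟫ * φ (‖V x‖ ^ 2 + 2 * P x)) r =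
      r ^ (1 - α) *
        sphereIntegral μ (fun x => ⟪V x, x⟫ * φ (r ^ (-(2 * α)) * (‖V x‖ ^ 2 + 2 * P x))) 1 := by
  rw [sphereIntegral_def, sphereIntegral_def, ← integral_const_mul]
  refine integral_congr_ae (ae_of_all _ fun ω => ?_)
  have hω : (ω : E) ≠ 0 := ne_zero_of_mem_unit_sphere ω
  simp only [one_smul]
  rw [h.normalPart_smul_eq hr hω, h.bernoulliFn_smul_eq hr hω]
  ring

end Engine

/-! ### C. Lemma 6.1: the generic exponents, the exceptional exponent, the case `n = 0` -/

section Moments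

variable (h : IsHomogeneousSteadyEuler α V P)
include h

/-- **Shvydkoy 2018, Lemma 6.1 — generic exponent.** In dimension `3`, if `α (2n+1) ≠ 2` then
`∫_{S²} f Hⁿ dσ = 0` (`f = ⟪V, x⟫`, `H = ‖V‖² + 2P` on the unit sphere): the flux of `Hⁿ V`
through the sphere of radius `r` is `r^{2-α(2n+1)} ∫_{S²} f Hⁿ dσ` and does not depend on `r`
("for all `n ∈ ℕ` except a possible `n₀` for which `α = 2/(1+2n₀)`"; `n = 0`: "if `α ≠ 2`").
[cite: Shvydkoy2018, Lemma 6.1 and its proof (arXiv p. 14)] -/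
theorem sphereIntegral_moment_eq_zero_of_ne [Nontrivial E] (h3 : finrank ℝ E = 3) (n : ℕ)
    (hne : α * (2 * n + 1) ≠ 2) :
    sphereIntegral μ (fun x => ⟪V x, x⟫ * (‖V x‖ ^ 2 + 2 * P x) ^ n) 1 = 0 := by
  set M := sphereIntegral μ (fun x => ⟪V x, x⟫ * (‖V x‖ ^ 2 + 2 * P x) ^ n) 1 with hM
  have hflux : (1 : ℝ) ^ (finrank ℝ E - 1) * ((1 : ℝ)⁻¹ * M) =
      (2 : ℝ) ^ (finrank ℝ E - 1) * ((2 : ℝ)⁻¹ *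
        sphereIntegral μ (fun x => ⟪V x, x⟫ * (‖V x‖ ^ 2 + 2 * P x) ^ n) 2) :=
    h.flux_eq_flux μ (φ := fun s : ℝ => s ^ n) (contDiff_id.pow n) one_pos two_pos
  have h2 : sphereIntegral μ (fun x => ⟪V x, x⟫ * (‖V x‖ ^ 2 + 2 * P x) ^ n) 2 =
      (2 : ℝ) ^ (1 - α) * sphereIntegral μ
        (fun x => ⟪V x, x⟫ * ((2 : ℝ) ^ (-(2 * α)) * (‖V x‖ ^ 2 + 2 * P x)) ^ n) 1 :=
    h.sphereIntegral_moment_eq_rpow_mul μ (fun s : ℝ => s ^ n) two_pos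
  have hin : sphereIntegral μ
      (fun x => ⟪V x, x⟫ * ((2 : ℝ) ^ (-(2 * α)) * (‖V x‖ ^ 2 + 2 * P x)) ^ n) 1 =
        ((2 : ℝ) ^ (-(2 * α))) ^ n * M := by
    rw [hM, sphereIntegral_def, sphereIntegral_def, ← integral_const_mul]
    refine integral_congr_ae (ae_of_all _ fun ω => ?_)
    simp only [mul_pow]
    ring
  rw [h3, h2, hin] at hflux
  simp only [show (3 : ℕ) - 1 = 2 from rfl, one_pow, inv_one, one_mul] at hflux
  -- `hflux : M = 2 ^ 2 * (2⁻¹ * (2 ^ (1 - α) * ((2 ^ (-2α)) ^ n * M)))`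
  have hpow : (2 : ℝ) ^ (2 : ℕ) * ((2 : ℝ)⁻¹ * ((2 : ℝ) ^ (1 - α) * ((2 : ℝ) ^ (-(2 * α))) ^ n)) =
      (2 : ℝ) ^ (2 - α * (2 * n + 1)) := by
    have e1 : (2 : ℝ) ^ (2 : ℕ) * (2 : ℝ)⁻¹ = (2 : ℝ) ^ (1 : ℝ) := by norm_num
    have e2 : ((2 : ℝ) ^ (-(2 * α))) ^ n = (2 : ℝ) ^ (-(2 * α) * n) := by
      rw [Real.rpow_mul zero_le_two, Real.rpow_natCast]
    calc (2 : ℝ) ^ (2 : ℕ) * ((2 : ℝ)⁻¹ * ((2 : ℝ) ^ (1 - α) * ((2 : ℝ) ^ (-(2 * α))) ^ n))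
        = ((2 : ℝ) ^ (2 : ℕ) * (2 : ℝ)⁻¹) * ((2 : ℝ) ^ (1 - α) * ((2 : ℝ) ^ (-(2 * α))) ^ n) := by
          ring
      _ = (2 : ℝ) ^ ((1 : ℝ) + ((1 - α) + -(2 * α) * n)) := by
          rw [e1, e2, Real.rpow_add two_pos, Real.rpow_add two_pos]
      _ = (2 : ℝ) ^ (2 - α * (2 * n + 1)) := by
          congr 1
          ring
  have hM' : M = (2 : ℝ) ^ (2 - α * (2 * n + 1)) * M := by
    rw [← hpow]
    linear_combination hflux
  have hne1 : (2 : ℝ) ^ (2 - α * (2 * n + 1)) ≠ 1 := by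
    intro h1
    have hexp : 2 - α * (2 * n + 1) ≠ 0 := fun h0 => hne (by linarith)
    rcases lt_or_gt_of_ne hexp with hlt | hgt
    · exact absurd h1 (ne_of_lt (Real.rpow_lt_one_of_one_lt_of_neg one_lt_two hlt))
    · exact absurd h1 (ne_of_gt (Real.one_lt_rpow one_lt_two hgt))
  have hzero : M * (1 - (2 : ℝ) ^ (2 - α * (2 * n + 1))) = 0 := by linear_combination hM'
  rcases mul_eq_zero.1 hzero with h0 | h1
  · exact h0
  · exact absurd (by linarith : (2 : ℝ) ^ (2 - α * (2 * n + 1)) = 1) hne1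

/-- **Shvydkoy 2018, Lemma 6.1 — the exceptional exponent `α = 2/(2n+1)`, `n ≥ 1`.** Then too
`∫_{S²} f Hⁿ dσ = 0`.  Printed: "`∫ f H^{n₀} Hᵏ dσ = 0` for all `k ≥ 1`, consequently
`∫ f H^{n₀} G(H) dσ = 0` for all real analytic `G` with `G(0) = 0`; letting
`G(x) = 1 - e^{-x²/ε}`, `ε → 0`, `∫_{H ≠ 0} f H^{n₀} = 0`".  Here the same limit is run on the
bounded renormalisation `φ(s) = sⁿ/(1+s²)` directly (a shorter road in Lean): by homogeneity
the flux of `φ(Q) V` through the sphere of radius `r` is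
`Ψ(t) = ∫_{S²} f Hⁿ/(1 + t²H²) dσ`, `t = r^{-2α}`, so `Ψ` is constant on `(0, ∞)`
(`flux_eq_flux`), while `Ψ(t) → ∫ f Hⁿ dσ` as `t → 0` and `Ψ(t) → ∫_{H = 0} f Hⁿ dσ = 0` as
`t → ∞` (dominated convergence on the sphere). [cite: Shvydkoy2018, Lemma 6.1 and its proof (arXiv p. 14)] -/
theorem sphereIntegral_moment_eq_zero_of_eq [Nontrivial E] (h3 : finrank ℝ E = 3) {n : ℕ}
    (hn : n ≠ 0) (hex : α * (2 * n + 1) = 2) :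
    sphereIntegral μ (fun x => ⟪V x, x⟫ * (‖V x‖ ^ 2 + 2 * P x) ^ n) 1 = 0 := by
  have hn2 : (0 : ℝ) < 2 * n + 1 := by positivity
  have hα : 0 < α := by
    by_contra hle
    have : α * (2 * n + 1) ≤ 0 := mul_nonpos_of_nonpos_of_nonneg (not_lt.1 hle) hn2.le
    linarith
  have hα0 : α ≠ 0 := hα.ne'
  set M := sphereIntegral μ (fun x => ⟪V x, x⟫ * (‖V x‖ ^ 2 + 2 * P x) ^ n) 1 with hM
  -- the bounded renormalisation `φ(s) = sⁿ/(1+s²)` and the function `Ψ`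
  set Ψ : ℝ → ℝ := fun t => sphereIntegral μ (fun x => ⟪V x, x⟫ *
    ((‖V x‖ ^ 2 + 2 * P x) ^ n / (1 + (t * (‖V x‖ ^ 2 + 2 * P x)) ^ 2))) 1 with hΨ
  have hφ : ContDiff ℝ 1 (fun s : ℝ => s ^ n / (1 + s ^ 2)) :=
    (contDiff_id.pow n).div (contDiff_const.add (contDiff_id.pow 2)) fun s => by positivity
  -- homogeneity: the sphere integral of `⟪V, x⟫ φ(Q)` at radius `r`
  have hscale : ∀ r : ℝ, 0 < r →
      sphereIntegral μ (fun x => ⟪V x, x⟫ *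
        ((‖V x‖ ^ 2 + 2 * P x) ^ n / (1 + (‖V x‖ ^ 2 + 2 * P x) ^ 2))) r =
        r ^ (1 - α) * ((r ^ (-(2 * α))) ^ n * Ψ (r ^ (-(2 * α)))) := by
    intro r hr
    have e : sphereIntegral μ (fun x => ⟪V x, x⟫ *
        ((‖V x‖ ^ 2 + 2 * P x) ^ n / (1 + (‖V x‖ ^ 2 + 2 * P x) ^ 2))) r =
        r ^ (1 - α) * sphereIntegral μ (fun x => ⟪V x, x⟫ *
          ((r ^ (-(2 * α)) * (‖V x‖ ^ 2 + 2 * P x)) ^ n /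
            (1 + (r ^ (-(2 * α)) * (‖V x‖ ^ 2 + 2 * P x)) ^ 2))) 1 :=
      h.sphereIntegral_moment_eq_rpow_mul μ (fun s : ℝ => s ^ n / (1 + s ^ 2)) hr
    rw [e]
    congr 1
    simp only [hΨ]
    rw [sphereIntegral_def, sphereIntegral_def, ← integral_const_mul]
    refine integral_congr_ae (ae_of_all _ fun ω => ?_)
    simp only [mul_pow]
    ring
  -- flux constancy at the exceptional exponent: `Ψ(r^{-2α}) = Ψ(1)`
  have hconstR : ∀ r : ℝ, 0 < r → Ψ (r ^ (-(2 * α))) = Ψ 1 := by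
    intro r hr
    have hflux : r ^ (finrank ℝ E - 1) * (r⁻¹ * sphereIntegral μ (fun x => ⟪V x, x⟫ *
        ((‖V x‖ ^ 2 + 2 * P x) ^ n / (1 + (‖V x‖ ^ 2 + 2 * P x) ^ 2))) r) =
        (1 : ℝ) ^ (finrank ℝ E - 1) * ((1 : ℝ)⁻¹ * sphereIntegral μ (fun x => ⟪V x, x⟫ *
          ((‖V x‖ ^ 2 + 2 * P x) ^ n / (1 + (‖V x‖ ^ 2 + 2 * P x) ^ 2))) 1) :=
      h.flux_eq_flux μ hφ hr one_pos
    rw [h3, hscale r hr, hscale 1 one_pos] at hflux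
    simp only [show (3 : ℕ) - 1 = 2 from rfl, one_pow, inv_one, one_mul, Real.one_rpow] at hflux
    -- `hflux : r ^ 2 * (r⁻¹ * (r ^ (1-α) * ((r ^ (-2α)) ^ n * Ψ (r ^ (-2α))))) = Ψ 1`
    have hpow : r ^ (2 : ℕ) * (r⁻¹ * (r ^ (1 - α) * (r ^ (-(2 * α))) ^ n)) = 1 := by
      have e1 : r ^ (2 : ℕ) * r⁻¹ = r ^ (1 : ℝ) := by
        rw [Real.rpow_one, pow_two, mul_inv_cancel_right₀ hr.ne']
      have e2 : (r ^ (-(2 * α))) ^ n = r ^ (-(2 * α) * n) := by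
        rw [Real.rpow_mul hr.le, Real.rpow_natCast]
      calc r ^ (2 : ℕ) * (r⁻¹ * (r ^ (1 - α) * (r ^ (-(2 * α))) ^ n))
          = (r ^ (2 : ℕ) * r⁻¹) * (r ^ (1 - α) * (r ^ (-(2 * α))) ^ n) := by ring
        _ = r ^ ((1 : ℝ) + ((1 - α) + -(2 * α) * n)) := by
            rw [e1, e2, Real.rpow_add hr, Real.rpow_add hr]
        _ = r ^ (0 : ℝ) := by
            congr 1
            linear_combination -hex
        _ = 1 := Real.rpow_zero r
    calc Ψ (r ^ (-(2 * α)))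
        = (r ^ (2 : ℕ) * (r⁻¹ * (r ^ (1 - α) * (r ^ (-(2 * α))) ^ n))) * Ψ (r ^ (-(2 * α))) := by
          rw [hpow, one_mul]
      _ = Ψ 1 := by
          rw [← hflux]
          ring
  have hconst : ∀ t : ℝ, 0 < t → Ψ t = Ψ 1 := by
    intro t ht
    have e := hconstR (t ^ (-(1 / (2 * α)))) (Real.rpow_pos_of_pos ht _)
    rwa [← Real.rpow_mul ht.le, show -(1 / (2 * α)) * -(2 * α) = 1 by field_simp,
      Real.rpow_one] at e
  -- the integrands on the unit sphere
  have hVc : Continuous fun ω : sphere (0 : E) 1 => V (ω : E) :=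
    h.contDiffOn_velocity.continuousOn.comp_continuous continuous_subtype_val
      fun ω => ne_zero_of_mem_unit_sphere ω
  have hQc : Continuous fun ω : sphere (0 : E) 1 => ‖V (ω : E)‖ ^ 2 + 2 * P (ω : E) :=
    h.contDiffOn_bernoulliFn'.continuousOn.comp_continuous continuous_subtype_val
      fun ω => ne_zero_of_mem_unit_sphere ω
  have hFc : Continuous fun ω : sphere (0 : E) 1 => ⟪V (ω : E), (ω : E)⟫ :=
    hVc.inner continuous_subtype_val
  have hΨint : ∀ t : ℝ, Ψ t = ∫ ω, ⟪V (ω : E), (ω : E)⟫ *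
      ((‖V (ω : E)‖ ^ 2 + 2 * P (ω : E)) ^ n /
        (1 + (t * (‖V (ω : E)‖ ^ 2 + 2 * P (ω : E))) ^ 2)) ∂μ.toSphere := by
    intro t
    simp only [hΨ]
    rw [sphereIntegral_def]
    simp only [one_smul]
  have hMint : M = ∫ ω, ⟪V (ω : E), (ω : E)⟫ * (‖V (ω : E)‖ ^ 2 + 2 * P (ω : E)) ^ n
      ∂μ.toSphere := by
    rw [hM, sphereIntegral_def]
    simp only [one_smul]
  have hmeas : ∀ t : ℝ, AEStronglyMeasurable (fun ω : sphere (0 : E) 1 => ⟪V (ω : E), (ω : E)⟫ *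
      ((‖V (ω : E)‖ ^ 2 + 2 * P (ω : E)) ^ n /
        (1 + (t * (‖V (ω : E)‖ ^ 2 + 2 * P (ω : E))) ^ 2))) μ.toSphere :=
    fun t => (hFc.mul ((hQc.pow n).div (continuous_const.add ((continuous_const.mul hQc).pow 2))
      fun ω => (add_pos_of_pos_of_nonneg one_pos (sq_nonneg _)).ne')).aestronglyMeasurable
  have hbound : Integrable (fun ω : sphere (0 : E) 1 =>
      |⟪V (ω : E), (ω : E)⟫ * (‖V (ω : E)‖ ^ 2 + 2 * P (ω : E)) ^ n|) μ.toSphere :=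
    integrableOn_univ.1
      (((hFc.mul (hQc.pow n)).abs).continuousOn.integrableOn_compact isCompact_univ)
  have hdom : ∀ (t : ℝ) (ω : sphere (0 : E) 1), ‖⟪V (ω : E), (ω : E)⟫ *
      ((‖V (ω : E)‖ ^ 2 + 2 * P (ω : E)) ^ n /
        (1 + (t * (‖V (ω : E)‖ ^ 2 + 2 * P (ω : E))) ^ 2))‖ ≤
      |⟪V (ω : E), (ω : E)⟫ * (‖V (ω : E)‖ ^ 2 + 2 * P (ω : E)) ^ n| := by
    intro t ω
    rw [Real.norm_eq_abs, ← mul_div_assoc, abs_div,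
      abs_of_pos (by positivity : (0 : ℝ) < 1 + (t * (‖V (ω : E)‖ ^ 2 + 2 * P (ω : E))) ^ 2)]
    exact div_le_self (abs_nonneg _) (le_add_of_nonneg_right (sq_nonneg _))
  -- `t → 0⁺`: `Ψ(1/(k+1)) → M`
  have hlim0 : Tendsto (fun k : ℕ => Ψ (1 / ((k : ℝ) + 1))) atTop (𝓝 M) := by
    have hpt : ∀ ω : sphere (0 : E) 1, Tendsto (fun k : ℕ => ⟪V (ω : E), (ω : E)⟫ *
        ((‖V (ω : E)‖ ^ 2 + 2 * P (ω : E)) ^ n /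
          (1 + (1 / ((k : ℝ) + 1) * (‖V (ω : E)‖ ^ 2 + 2 * P (ω : E))) ^ 2))) atTop
        (𝓝 (⟪V (ω : E), (ω : E)⟫ * (‖V (ω : E)‖ ^ 2 + 2 * P (ω : E)) ^ n)) := by
      intro ω
      have ht : Tendsto (fun k : ℕ => 1 / ((k : ℝ) + 1)) atTop (𝓝 0) :=
        tendsto_one_div_add_atTop_nhds_zero_nat
      have hden : Tendsto (fun k : ℕ =>
          1 + (1 / ((k : ℝ) + 1) * (‖V (ω : E)‖ ^ 2 + 2 * P (ω : E))) ^ 2) atTop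
          (𝓝 (1 + (0 * (‖V (ω : E)‖ ^ 2 + 2 * P (ω : E))) ^ 2)) :=
        tendsto_const_nhds.add ((ht.mul tendsto_const_nhds).pow 2)
      rw [zero_mul, zero_pow two_ne_zero, add_zero] at hden
      have := (tendsto_const_nhds (x := (‖V (ω : E)‖ ^ 2 + 2 * P (ω : E)) ^ n)).div hden
        one_ne_zero
      rw [div_one] at this
      exact this.const_mul _
    have key := tendsto_integral_of_dominated_convergence _ (fun k => hmeas (1 / ((k : ℝ) + 1)))
      hbound (fun k => ae_of_all _ fun ω => hdom _ ω) (ae_of_all _ hpt)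
    rw [← hMint] at key
    simp_rw [hΨint]
    exact key
  -- `t → ∞`: `Ψ(k+1) → 0`
  have hlimI : Tendsto (fun k : ℕ => Ψ ((k : ℝ) + 1)) atTop (𝓝 0) := by
    have hpt : ∀ ω : sphere (0 : E) 1, Tendsto (fun k : ℕ => ⟪V (ω : E), (ω : E)⟫ *
        ((‖V (ω : E)‖ ^ 2 + 2 * P (ω : E)) ^ n /
          (1 + (((k : ℝ) + 1) * (‖V (ω : E)‖ ^ 2 + 2 * P (ω : E))) ^ 2))) atTop (𝓝 0) := by
      intro ω
      by_cases hQ : ‖V (ω : E)‖ ^ 2 + 2 * P (ω : E) = 0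
      · simp only [hQ, zero_pow hn, zero_div, mul_zero]
        exact tendsto_const_nhds
      · have ht : Tendsto (fun k : ℕ => (k : ℝ) + 1) atTop atTop :=
          tendsto_atTop_add_const_right _ _ tendsto_natCast_atTop_atTop
        have hsq : Tendsto (fun k : ℕ =>
            1 + (((k : ℝ) + 1) * (‖V (ω : E)‖ ^ 2 + 2 * P (ω : E))) ^ 2) atTop atTop := by
          have h2 : Tendsto (fun k : ℕ =>
              ((k : ℝ) + 1) ^ 2 * (‖V (ω : E)‖ ^ 2 + 2 * P (ω : E)) ^ 2) atTop atTop :=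
            ((tendsto_pow_atTop two_ne_zero).comp ht).atTop_mul_const (pow_pos (abs_pos.2 hQ) 2 |>.trans_eq (by rw [sq_abs]))
          refine tendsto_atTop_add_const_left _ _ ?_
          simpa only [mul_pow] using h2
        have hinv : Tendsto (fun k : ℕ =>
            (1 + (((k : ℝ) + 1) * (‖V (ω : E)‖ ^ 2 + 2 * P (ω : E))) ^ 2)⁻¹) atTop (𝓝 0) :=
          tendsto_inv_atTop_zero.comp hsq
        have := hinv.const_mul (⟪V (ω : E), (ω : E)⟫ * (‖V (ω : E)‖ ^ 2 + 2 * P (ω : E)) ^ n)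
        rw [mul_zero] at this
        exact this.congr fun k => by ring
    have key := tendsto_integral_of_dominated_convergence _ (fun k => hmeas ((k : ℝ) + 1))
      hbound (fun k => ae_of_all _ fun ω => hdom _ ω) (ae_of_all _ hpt)
    rw [integral_zero] at key
    simp_rw [hΨint]
    exact key
  -- the two limits of the constant function `Ψ` agree
  have hc0 : Tendsto (fun k : ℕ => Ψ (1 / ((k : ℝ) + 1))) atTop (𝓝 (Ψ 1)) := by
    have e : (fun k : ℕ => Ψ (1 / ((k : ℝ) + 1))) = fun _ => Ψ 1 :=
      funext fun k => hconst _ (by positivity)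
    rw [e]
    exact tendsto_const_nhds
  have hcI : Tendsto (fun k : ℕ => Ψ ((k : ℝ) + 1)) atTop (𝓝 (Ψ 1)) := by
    have e : (fun k : ℕ => Ψ ((k : ℝ) + 1)) = fun _ => Ψ 1 :=
      funext fun k => hconst _ (by positivity)
    rw [e]
    exact tendsto_const_nhds
  rw [tendsto_nhds_unique hlim0 hc0]
  exact (tendsto_nhds_unique hlimI hcI).symm

end Moments

end Flux

end IsHomogeneousSteadyEuler

/-- **Shvydkoy 2018, Lemma 6.1, PROVED**: the named fact `shvydkoy2018_lemma61_sphereMoments`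
holds — for every `C¹` (a fortiori every smooth) homogeneous stationary Euler pair on `ℝ³ ∖ {0}`
and every `n ≥ 1`, `∫_{S²} f Hⁿ dσ = 0`, and `∫_{S²} f dσ = 0` if `α ≠ 2`.
[cite: Shvydkoy2018, Lemma 6.1 (arXiv p. 14)] -/
theorem shvydkoy2018_lemma61_sphereMoments_holds : shvydkoy2018_lemma61_sphereMoments := by
  intro α V P hVP _ _
  refine ⟨fun n hn => ?_, fun hα => ?_⟩
  · by_cases hex : α * (2 * n + 1) = 2
    · exact hVP.sphereIntegral_moment_eq_zero_of_eq volume finrank_euclideanSpace_fin hn hex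
    · exact hVP.sphereIntegral_moment_eq_zero_of_ne volume finrank_euclideanSpace_fin n hex
  · have hne : α * (2 * ((0 : ℕ) : ℝ) + 1) ≠ 2 := by simpa using hα
    simpa using hVP.sphereIntegral_moment_eq_zero_of_ne volume finrank_euclideanSpace_fin 0 hne

end Literature.Analysis.FluidPDE

end
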